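import Literature.IUT.LogVolume.TameDualPair
import Literature.IUT.LogVolume.PacketBases
import Literature.NumberTheory.GaloisRepresentations.PadicAlgClFiniteSubextensionDvr
import Mathlib.RingTheory.Trace.Basic
import Mathlib.FieldTheory.IsAlgClosed.Basic
import HarnessLib

/-!
# Dedekind coefficients through EMBEDDINGS `K → ℚ̄_p`: at a tame `p`-adic field — Galois or not — the isometries are the units of the
# integral EMBEDDING order, and such units preserve the normalised packet `(R_I)^∼` of EVERY tensor packet

abc-iut cell, seat abc-iut-E-t42 (gen 5; rung LADDER-ABC:A2.RESCUE.J, R-J row Y-29b «dividing line of the isometric (Ind2)»).  PROOF-ONLY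
classical local algebra (Serre, *Local Fields* III §3; Neukirch II (4.8)); no definition, no `Prop` fact, no `sorry`.  Sequel of this
seat's `IsometryGaloisOrder.lean` (p462048) and `TameDualPair.lean` (p464861), which needed `K/ℚ_p` GALOIS to write an isometry as
`Σ_τ c_τ·τ` over AUTOMORPHISMS `τ`.  Here the automorphisms are replaced by the EMBEDDINGS `σ : K → ℚ̄_p` (`PadicAlgCl p`, Mathlib's
algebraic closure of `ℚ_p` with its spectral norm), of which there are always `[K:ℚ_p]`: the Galois hypothesis disappears.

* §1 `algHom_apply_eq_sum_dedekindCoeff_mul` — for ANY finite `K/ℚ_p`, a trace-dual pair of `ℚ_p`-bases `(b, d)` (`Tr(d_i b_j) = δ_{ij}`),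
  any `ℚ_p`-linear `f : K → K` and any embedding `ι : K → E` into an algebraically closed `E`:
  `ι(f x) = Σ_{σ : K →ₐ E} a_σ·σ(x)` with `a_σ = Σ_m ι(f b_m)·σ(d_m)` (Mathlib `trace_eq_sum_embeddings` + the dual expansion
  `x = Σ_m Tr(x d_m)·b_m` of `PacketDifferentSharp`).
* §2 (`E = ℚ̄_p`) `norm_dedekindCoeff_le_one` — at a NORM-UNIMODULAR pair (`‖b_m‖·‖d_m‖ ≤ 1`) a norm-non-increasing `f` has `‖a_σ‖ ≤ 1`
  (embeddings are isometries — campaign-S `norm_map_algHom`); `exists_embeddingOrder_repr_of_norm_le`, `…_of_isometry`, and, with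
  p464861's `TameDualPair.exists_normUnimodular_dualPair_of_not_wild`, **`exists_embeddingOrder_repr_of_isometry_of_not_wild`**:
  `¬ (∀ x, ‖x‖ ≤ 1 → ‖Tr x‖ < 1)` (TAME) ⟹ every `ℚ_p`-linear isometry `g` of `K` satisfies `ι∘g = Σ_σ c_σ·σ`, `ι∘g⁻¹ = Σ_σ c′_σ·σ`
  with `‖c_σ‖, ‖c′_σ‖ ≤ 1` — NO Galois hypothesis; conversely `norm_map_eq_of_embeddingOrder`: such `g` are isometries; and
  `nonempty_algHom_padicAlgCl` (an embedding exists, Mathlib `IsAlgClosed.lift`).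
* §3 `packetAlgHom_injective` — `⊗_i ι_i : ⊗_{ℚ_p} k_i → ⊗_{ℚ_p} k'_i` is INJECTIVE for field embeddings `ι_i` (left inverses slot by
  slot; campaign `map_comp_eq_id_of_retraction`); **`map_mem_normalizedPacket_of_embeddingOrder`** — if every slot map `f_i` satisfies
  `ι_i∘f_i = Σ_{τ ∈ T_i} c_{i,τ}·τ` (`τ : k_i →ₐ ℚ̄_p`, `‖c_{i,τ}‖ ≤ 1`) then `⊗_i f_i` maps `(R_I)^∼` into itself: `ψ := ⊗ι_i` sends
  `(⊗ f_i)(z)` to `Σ_{τ⃗} (⊗ c_{i,τ_i})·(⊗ τ_i)(z)`, which is `ℤ_p`-integral in `⊗_i ℚ̄_p` (`⊗τ_i` is a `ℚ_p`-algebra map —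
  `exists_packetAlgHom_of_algHom`; `‖c‖ ≤ 1 ⟹ c` integral — `PadicAlgCl.norm_le_one_iff_isIntegral`), and `ℤ_p`-integrality REFLECTS
  along the injective algebra map `ψ` (Mathlib `isIntegral_algHom_iff`); **`congr_image_normalizedPacket_of_embeddingOrder`**,
  `congr_image_natCast_smul_normalizedPacket_of_embeddingOrder` — `(⊗ g_i)(n·(R_I)^∼) = n·(R_I)^∼` for embedding-order UNITS `g_i`.

Consumers: the cell's `Summit.ABC.IUTFork.Joshi.PinsIsometricLine` (p460595 / p465219), whose tame positive half of row Y-29b's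
dividing line asked `IsGalois ℚ_p K_v` at the places over ramified primes; with this file that proviso is dropped (Joshi-side sequel
`TestRealPinsIsometricTameLine.lean`).  Nothing here is disputed mathematics; the consumer rows are the cell's typings
[claim: Mochizuki2012, status: disputed] of (Ind2). [cite: SerreLocalFields1979, Ch. III §3, Prop. 7] [cite: NeukirchANT1999, Ch. II (4.8)]
[cite: Mochizuki2012, IUTchIV Prop. 1.1 p. 9]
-/

noncomputable section

open Module
open scoped Pointwise

namespace Literature.IUT.LogVolume

namespace EmbeddingOrder

/-! ## §1 Dedekind expansion through the embeddings into an algebraically closed field -/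

section Dedekind

variable {p : ℕ} [Fact p.Prime] {K : Type} [NontriviallyNormedField K] [NormedAlgebra ℚ_[p] K] [FiniteDimensional ℚ_[p] K]
variable {E : Type} [Field E] [Algebra ℚ_[p] E] [IsAlgClosed E]
variable {κ : Type} [Fintype κ] [DecidableEq κ] (b d : Basis κ ℚ_[p] K)
  (hbd : ∀ i j, Algebra.trace ℚ_[p] K (d i * b j) = if j = i then 1 else 0)
include hbd

/-- **Dedekind expansion through embeddings.**  For ANY finite `K/ℚ_p` (no Galois hypothesis), a trace-dual pair of `ℚ_p`-bases
`(b, d)` (`Tr(d_i b_j) = δ_{ij}`), a `ℚ_p`-linear `f : K → K` and a `ℚ_p`-embedding `ι : K → E` into an algebraically closed `E`: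
`ι(f x) = Σ_{σ : K →ₐ E} (Σ_m ι(f b_m)·σ(d_m))·σ(x)` — expand `x = Σ_m Tr(x d_m)·b_m` and use `Tr(y) = Σ_σ σ(y)` in `E`
(Mathlib `trace_eq_sum_embeddings`; `K/ℚ_p` is separable). [cite: SerreLocalFields1979, Ch. III §3] [cite: NeukirchANT1999, Ch. II (4.8)] -/
theorem algHom_apply_eq_sum_dedekindCoeff_mul (ι : K →ₐ[ℚ_[p]] E) (f : K →ₗ[ℚ_[p]] K) (x : K) :
    ι (f x) = ∑ σ : K →ₐ[ℚ_[p]] E, (∑ m, ι (f (b m)) * σ (d m)) * σ x := by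
  calc ι (f x) = ι (f (∑ m, Algebra.trace ℚ_[p] K (x * d m) • b m)) := by rw [dualPair_sum_trace_mul_smul' b d hbd x]
    _ = ∑ m, ι (f (b m)) * algebraMap ℚ_[p] E (Algebra.trace ℚ_[p] K (x * d m)) := by
        rw [map_sum, map_sum]
        exact Finset.sum_congr rfl fun m _ => by rw [map_smul, map_smul, Algebra.smul_def, mul_comm]
    _ = ∑ m, ι (f (b m)) * ∑ σ : K →ₐ[ℚ_[p]] E, σ (x * d m) := by simp_rw [trace_eq_sum_embeddings E]
    _ = ∑ σ : K →ₐ[ℚ_[p]] E, (∑ m, ι (f (b m)) * σ (d m)) * σ x := by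
        simp_rw [Finset.mul_sum, Finset.sum_mul]
        rw [Finset.sum_comm]
        exact Finset.sum_congr rfl fun σ _ => Finset.sum_congr rfl fun m _ => by rw [map_mul]; ring

end Dedekind

/-! ## §2 `E = ℚ̄_p`: integrality of the coefficients at a norm-unimodular pair; TAME ⟹ isometries are embedding-order units -/

section PadicAlgCl

variable {p : ℕ} [Fact p.Prime] {K : Type} [NontriviallyNormedField K] [NormedAlgebra ℚ_[p] K] [IsUltrametricDist K] [ProperSpace K]
variable {κ : Type} [Fintype κ] (b d : Basis κ ℚ_[p] K)

omit [IsUltrametricDist K] in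
/-- **Integrality of the Dedekind coefficients at a NORM-UNIMODULAR dual pair**: if `‖b_m‖·‖d_m‖ ≤ 1` for all `m` and `f` does not
increase norms then `‖Σ_m ι(f b_m)·σ(d_m)‖ ≤ 1` in `ℚ̄_p` for all embeddings `ι, σ : K → ℚ̄_p` (ultrametric inequality; embeddings of
the locally compact `K` are isometries — campaign-S `norm_map_algHom`). [cite: NeukirchANT1999, Ch. II (4.8)] -/
theorem norm_dedekindCoeff_le_one (hnorm : ∀ m, ‖b m‖ * ‖d m‖ ≤ 1) (f : K →ₗ[ℚ_[p]] K) (hf : ∀ x, ‖f x‖ ≤ ‖x‖)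
    (ι σ : K →ₐ[ℚ_[p]] PadicAlgCl p) : ‖∑ m, ι (f (b m)) * σ (d m)‖ ≤ 1 := by
  refine IsUltrametricDist.norm_sum_le_of_forall_le_of_nonneg zero_le_one fun m _ => ?_
  rw [norm_mul, norm_map_algHom ι, norm_map_algHom σ]
  exact (mul_le_mul_of_nonneg_right (hf (b m)) (norm_nonneg _)).trans (hnorm m)

variable [DecidableEq κ] (hbd : ∀ i j, Algebra.trace ℚ_[p] K (d i * b j) = if j = i then 1 else 0)
include hbd

/-- **A norm-non-increasing `ℚ_p`-linear endomorphism of a field with a norm-unimodular trace-dual pair lies in the INTEGRAL EMBEDDING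
ORDER**: for every embedding `ι : K → ℚ̄_p`, `ι∘f = Σ_{τ ∈ T} c_τ·τ` over embeddings `τ : K → ℚ̄_p` with `‖c_τ‖ ≤ 1` (here `T` = all
embeddings and `c_τ` = the Dedekind coefficients of §1).  No Galois hypothesis. [cite: SerreLocalFields1979, Ch. III §3]
[cite: NeukirchANT1999, Ch. II (4.8)] -/
theorem exists_embeddingOrder_repr_of_norm_le (hnorm : ∀ m, ‖b m‖ * ‖d m‖ ≤ 1) (f : K →ₗ[ℚ_[p]] K) (hf : ∀ x, ‖f x‖ ≤ ‖x‖)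
    (ι : K →ₐ[ℚ_[p]] PadicAlgCl p) :
    ∃ (T : Finset (K →ₐ[ℚ_[p]] PadicAlgCl p)) (c : (K →ₐ[ℚ_[p]] PadicAlgCl p) → PadicAlgCl p),
      (∀ τ ∈ T, ‖c τ‖ ≤ 1) ∧ ∀ x, ι (f x) = ∑ τ ∈ T, c τ * τ x := by
  haveI := finiteDimensional p K
  exact ⟨Finset.univ, fun σ => ∑ m, ι (f (b m)) * σ (d m), fun σ _ => norm_dedekindCoeff_le_one b d hnorm f hf ι σ,
    fun x => algHom_apply_eq_sum_dedekindCoeff_mul b d hbd ι f x⟩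

/-- **Isometries are UNITS of the integral embedding order** (given a norm-unimodular trace-dual pair): for a `ℚ_p`-linear ISOMETRY `g`
and any embedding `ι : K → ℚ̄_p`, both `ι∘g` and `ι∘g⁻¹` are sums `Σ_τ c_τ·τ` over embeddings `τ : K → ℚ̄_p` with `‖c_τ‖ ≤ 1`.
[cite: SerreLocalFields1979, Ch. III §3] [cite: NeukirchANT1999, Ch. II (4.8)] -/
theorem exists_embeddingOrder_repr_of_isometry (hnorm : ∀ m, ‖b m‖ * ‖d m‖ ≤ 1) (g : K ≃ₗ[ℚ_[p]] K) (hg : ∀ x, ‖g x‖ = ‖x‖)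
    (ι : K →ₐ[ℚ_[p]] PadicAlgCl p) :
    (∃ (T : Finset (K →ₐ[ℚ_[p]] PadicAlgCl p)) (c : (K →ₐ[ℚ_[p]] PadicAlgCl p) → PadicAlgCl p),
      (∀ τ ∈ T, ‖c τ‖ ≤ 1) ∧ ∀ x, ι (g x) = ∑ τ ∈ T, c τ * τ x) ∧
    (∃ (T : Finset (K →ₐ[ℚ_[p]] PadicAlgCl p)) (c : (K →ₐ[ℚ_[p]] PadicAlgCl p) → PadicAlgCl p),
      (∀ τ ∈ T, ‖c τ‖ ≤ 1) ∧ ∀ x, ι (g.symm x) = ∑ τ ∈ T, c τ * τ x) :=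
  ⟨exists_embeddingOrder_repr_of_norm_le b d hbd hnorm g (fun x => (hg x).le) ι,
    exists_embeddingOrder_repr_of_norm_le b d hbd hnorm g.symm (fun x => by
      conv_rhs => rw [← g.apply_symm_apply x]
      rw [hg]
      exact le_rfl) ι⟩

omit [Fintype κ] [DecidableEq κ] b d hbd in
/-- **TAME ⟹ every isometry is a unit of the integral embedding order — NO Galois hypothesis.**  If the trace form of `K/ℚ_p` is NOT wild
(`¬ ∀ x, ‖x‖ ≤ 1 → ‖Tr x‖ < 1`, i.e. `Tr(𝒪_K) = ℤ_p`, tame ramification; the literal negation of the hypothesis `hwild` of the cell's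
negative half p457646) then for every `ℚ_p`-linear isometry `g` of `K` and every embedding `ι : K → ℚ̄_p`, both `ι∘g` and `ι∘g⁻¹` are sums
`Σ_τ c_τ·τ` over embeddings `τ : K → ℚ̄_p` with `‖c_τ‖ ≤ 1` (p464861's norm-unimodular dual pair + §1).  Compare p464861's
`TameDualPair.exists_galoisOrder_repr_of_isometry_of_not_wild`, which needed `IsGalois ℚ_p K` to sum over automorphisms.
[cite: SerreLocalFields1979, Ch. III §3, Prop. 7] [cite: NeukirchANT1999, Ch. II (4.8)] -/
theorem exists_embeddingOrder_repr_of_isometry_of_not_wild (h : ¬ ∀ x : K, ‖x‖ ≤ 1 → ‖Algebra.trace ℚ_[p] K x‖ < 1)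
    (g : K ≃ₗ[ℚ_[p]] K) (hg : ∀ x, ‖g x‖ = ‖x‖) (ι : K →ₐ[ℚ_[p]] PadicAlgCl p) :
    (∃ (T : Finset (K →ₐ[ℚ_[p]] PadicAlgCl p)) (c : (K →ₐ[ℚ_[p]] PadicAlgCl p) → PadicAlgCl p),
      (∀ τ ∈ T, ‖c τ‖ ≤ 1) ∧ ∀ x, ι (g x) = ∑ τ ∈ T, c τ * τ x) ∧
    (∃ (T : Finset (K →ₐ[ℚ_[p]] PadicAlgCl p)) (c : (K →ₐ[ℚ_[p]] PadicAlgCl p) → PadicAlgCl p),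
      (∀ τ ∈ T, ‖c τ‖ ≤ 1) ∧ ∀ x, ι (g.symm x) = ∑ τ ∈ T, c τ * τ x) := by
  classical
  obtain ⟨_, b, d, hbd, hnorm⟩ := TameDualPair.exists_normUnimodular_dualPair_of_not_wild h
  exact exists_embeddingOrder_repr_of_isometry b d hbd hnorm g hg ι

omit [Fintype κ] [DecidableEq κ] [IsUltrametricDist K] b d hbd in
/-- **Embedding-order elements with embedding-order inverse are ISOMETRIES**: if `ι∘g = Σ_τ c_τ·τ` and `ι′∘g⁻¹ = Σ_τ c′_τ·τ` with integral
coefficients then `‖g y‖ = ‖y‖` (`‖ι(g y)‖ = ‖g y‖`, `‖Σ c_τ τ(y)‖ ≤ max ‖c_τ‖·‖τ y‖ ≤ ‖y‖`, embeddings being isometries; same for `g⁻¹`).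
So at a TAME `K` the two classes coincide: embedding-order units = isometries. [cite: NeukirchANT1999, Ch. II (4.8)] -/
theorem norm_map_eq_of_embeddingOrder (g : K ≃ₗ[ℚ_[p]] K)
    (hg : ∃ (ι : K →ₐ[ℚ_[p]] PadicAlgCl p) (T : Finset (K →ₐ[ℚ_[p]] PadicAlgCl p)) (c : (K →ₐ[ℚ_[p]] PadicAlgCl p) → PadicAlgCl p),
      (∀ τ ∈ T, ‖c τ‖ ≤ 1) ∧ ∀ x, ι (g x) = ∑ τ ∈ T, c τ * τ x)
    (hg' : ∃ (ι : K →ₐ[ℚ_[p]] PadicAlgCl p) (T : Finset (K →ₐ[ℚ_[p]] PadicAlgCl p)) (c : (K →ₐ[ℚ_[p]] PadicAlgCl p) → PadicAlgCl p),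
      (∀ τ ∈ T, ‖c τ‖ ≤ 1) ∧ ∀ x, ι (g.symm x) = ∑ τ ∈ T, c τ * τ x)
    (y : K) : ‖g y‖ = ‖y‖ := by
  have hle : ∀ (f : K → K), (∃ (ι : K →ₐ[ℚ_[p]] PadicAlgCl p) (T : Finset (K →ₐ[ℚ_[p]] PadicAlgCl p))
      (c : (K →ₐ[ℚ_[p]] PadicAlgCl p) → PadicAlgCl p), (∀ τ ∈ T, ‖c τ‖ ≤ 1) ∧ ∀ x, ι (f x) = ∑ τ ∈ T, c τ * τ x) →
      ∀ x, ‖f x‖ ≤ ‖x‖ := by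
    rintro f ⟨ι, T, c, hc, hf⟩ x
    rw [← norm_map_algHom ι (f x), hf x]
    refine IsUltrametricDist.norm_sum_le_of_forall_le_of_nonneg (norm_nonneg x) fun τ hτ => ?_
    rw [norm_mul, norm_map_algHom τ]
    exact mul_le_of_le_one_left (norm_nonneg x) (hc τ hτ)
  refine le_antisymm (hle g hg y) ?_
  conv_lhs => rw [← g.symm_apply_apply y]
  exact hle g.symm hg' (g y)

omit [Fintype κ] [DecidableEq κ] b d hbd in
/-- An embedding `K → ℚ̄_p` EXISTS (`K/ℚ_p` is finite, hence algebraic: the extension theorem for embeddings into an algebraically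
closed field; Mathlib `IsAlgClosed.lift`). [cite: Lang2002, Ch. V §2 Thm. 2.8] -/
theorem nonempty_algHom_padicAlgCl : Nonempty (K →ₐ[ℚ_[p]] PadicAlgCl p) := by
  haveI := finiteDimensional p K
  exact ⟨IsAlgClosed.lift⟩

end PadicAlgCl

/-! ## §3 Tensor packets: embedding-order units preserve `(R_I)^∼` — any packet shape, no Galois hypothesis -/

section Packet

variable (p : ℕ) [hp : Fact p.Prime] {I : Type} [Fintype I] [DecidableEq I] [Nonempty I]
  (k : I → Type) [∀ i, NontriviallyNormedField (k i)] [∀ i, NormedAlgebra ℚ_[p] (k i)]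
  [∀ i, IsUltrametricDist (k i)] [∀ i, ProperSpace (k i)]

omit [Nonempty I] [∀ i, IsUltrametricDist (k i)] [∀ i, ProperSpace (k i)] in
/-- **`⊗_i ι_i` is INJECTIVE** for `ℚ_p`-algebra maps of fields `ι_i : k_i → k'_i`: each `ι_i` is an injective `ℚ_p`-linear map, so has a
`ℚ_p`-linear left inverse `r_i`, and `(⊗ r_i) ∘ (⊗ ι_i) = id` (campaign `map_comp_eq_id_of_retraction`) — the injectivity behind the
identification of `R_I ⊗ ℚ_p` inside a product of fields in [IUTchIV] Prop. 1.1. [cite: Mochizuki2012, IUTchIV Prop. 1.1 p. 9] -/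
theorem packetAlgHom_injective (k' : I → Type) [∀ i, NontriviallyNormedField (k' i)] [∀ i, NormedAlgebra ℚ_[p] (k' i)]
    (ι : ∀ i, k i →ₐ[ℚ_[p]] k' i) (ψ : PacketAlgebra p k →ₐ[ℚ_[p]] PacketAlgebra p k')
    (hψ : ∀ i a, ψ (iota p k i a) = iota p k' i (ι i a)) : Function.Injective ψ := by
  have hli : ∀ i, ∃ r : k' i →ₗ[ℚ_[p]] k i, r ∘ₗ (ι i).toLinearMap = LinearMap.id := fun i =>
    LinearMap.exists_leftInverse_of_injective _ (LinearMap.ker_eq_bot.mpr (ι i).injective)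
  choose r hr using hli
  have hleft : ∀ x, PiTensorProduct.map r (ψ x) = x :=
    map_comp_eq_id_of_retraction p k k' ψ ι hψ r fun i a => LinearMap.congr_fun (hr i) a
  intro x y hxy
  rw [← hleft x, ← hleft y, hxy]

/-- **Embedding-order slot maps preserve `(R_I)^∼`.**  If every slot map `f_i : k_i → k_i` satisfies `ι_i(f_i x) = Σ_{τ ∈ T_i} c_{i,τ}·τ(x)`
for embeddings `ι_i, τ : k_i → ℚ̄_p` and coefficients `‖c_{i,τ}‖ ≤ 1`, then `⊗_i f_i` maps `(R_I)^∼` (the integral closure of `ℤ_p` in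
`V = ⊗_{ℚ_p} k_i`, [IUTchIV] Prop. 1.1) into itself.  Proof: with `ψ := ⊗_i ι_i : V → ⊗_i ℚ̄_p` (a `ℚ_p`-algebra map,
`exists_packetAlgHom_of_algHom`), multilinearity gives `ψ((⊗ f_i) z) = Σ_{τ⃗ ∈ Π T_i} (⊗_i c_{i,τ_i})·(⊗_i τ_i)(z)`; each `⊗_i τ_i` is a
`ℚ_p`-algebra map so `(⊗ τ_i)(z)` is `ℤ_p`-integral for `z ∈ (R_I)^∼`, and `⊗ c_{i,τ_i} = Π_i ι'_i(c_{i,τ_i})` is `ℤ_p`-integral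
(`‖c‖ ≤ 1 ⟺ c` integral in `ℚ̄_p`); so `ψ((⊗ f_i) z)` is `ℤ_p`-integral, and since `ψ` is INJECTIVE (`packetAlgHom_injective`) and
integrality reflects along injective algebra maps (Mathlib `isIntegral_algHom_iff`), `(⊗ f_i) z ∈ (R_I)^∼`.
[cite: Mochizuki2012, IUTchIV Prop. 1.1 p. 9] [cite: NeukirchANT1999, Ch. II (4.8)] -/
theorem map_mem_normalizedPacket_of_embeddingOrder (ι : ∀ i, k i →ₐ[ℚ_[p]] PadicAlgCl p)
    (T : ∀ i, Finset (k i →ₐ[ℚ_[p]] PadicAlgCl p)) (c : ∀ i, (k i →ₐ[ℚ_[p]] PadicAlgCl p) → PadicAlgCl p)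
    (hc : ∀ i, ∀ τ ∈ T i, ‖c i τ‖ ≤ 1)
    (f : ∀ i, k i →ₗ[ℚ_[p]] k i) (hf : ∀ i x, ι i (f i x) = ∑ τ ∈ T i, c i τ * τ x)
    {z : PacketAlgebra p k} (hz : z ∈ normalizedPacket p k) : PiTensorProduct.map f z ∈ normalizedPacket p k := by
  obtain ⟨ψ, hψ⟩ := exists_packetAlgHom_of_algHom p k (fun _ : I => PadicAlgCl p) ι
  choose ψt hψt using fun t : (∀ i, k i →ₐ[ℚ_[p]] PadicAlgCl p) =>
    exists_packetAlgHom_of_algHom p k (fun _ : I => PadicAlgCl p) t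
  -- (1) the expansion `ψ ∘ (⊗ f_i) = Σ_{τ⃗} (⊗ c_{i,τ_i}) · ψ_{τ⃗}`
  have hlin : ψ.toLinearMap ∘ₗ PiTensorProduct.map f = ∑ t ∈ Fintype.piFinset T,
      LinearMap.mulLeft ℚ_[p] (purePacket p (fun _ : I => PadicAlgCl p) fun i => c i (t i)) ∘ₗ (ψt t).toLinearMap := by
    ext x
    simp only [LinearMap.compMultilinearMap_apply, LinearMap.comp_apply, PiTensorProduct.map_tprod, LinearMap.coe_sum,
      Finset.sum_apply, LinearMap.mulLeft_apply, AlgHom.toLinearMap_apply]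
    change ψ (purePacket p k fun i => f i (x i)) =
      ∑ t ∈ Fintype.piFinset T, purePacket p (fun _ : I => PadicAlgCl p) (fun i => c i (t i)) * ψt t (purePacket p k x)
    rw [map_purePacket_of_iota p k (fun _ : I => PadicAlgCl p) ψ ι hψ]
    have hfx : (fun i => ι i (f i (x i))) = fun i => ∑ τ ∈ T i, c i τ * τ (x i) := funext fun i => hf i (x i)
    rw [hfx]
    change PiTensorProduct.tprod ℚ_[p] (fun i => ∑ τ ∈ T i, c i τ * τ (x i)) = _
    rw [MultilinearMap.map_sum_finset (PiTensorProduct.tprod ℚ_[p]) (fun i τ => c i τ * τ (x i)) T]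
    refine Finset.sum_congr rfl fun t _ => ?_
    rw [map_purePacket_of_iota p k (fun _ : I => PadicAlgCl p) (ψt t) t (hψt t) x]
    change purePacket p (fun _ : I => PadicAlgCl p) (fun i => c i (t i) * t i (x i)) =
      purePacket p (fun _ : I => PadicAlgCl p) (fun i => c i (t i)) * purePacket p (fun _ : I => PadicAlgCl p) (fun i => t i (x i))
    rw [purePacket_mul]
    rfl
  have key : ψ (PiTensorProduct.map f z) =
      ∑ t ∈ Fintype.piFinset T, purePacket p (fun _ : I => PadicAlgCl p) (fun i => c i (t i)) * ψt t z := by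
    have h := LinearMap.congr_fun hlin z
    simpa only [LinearMap.comp_apply, AlgHom.toLinearMap_apply, LinearMap.coe_sum, Finset.sum_apply,
      LinearMap.mulLeft_apply] using h
  -- (2) the right-hand side is `ℤ_p`-integral
  have hint : IsIntegral ℤ_[p] (ψ (PiTensorProduct.map f z)) := by
    rw [key]
    refine IsIntegral.sum _ fun t ht => IsIntegral.mul ?_ ?_
    · rw [purePacket_eq_prod_iota]
      refine IsIntegral.prod _ fun i _ => ?_
      have hci : IsIntegral ℤ_[p] (c i (t i)) :=
        (Literature.NumberTheory.GaloisRepresentations.PadicAlgCl.norm_le_one_iff_isIntegral _).mp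
          (hc i (t i) (Fintype.mem_piFinset.mp ht i))
      exact hci.map ((iota p (fun _ : I => PadicAlgCl p) i).restrictScalars ℤ_[p])
    · exact (isIntegral_of_mem_normalizedPacket p k hz).map ((ψt t).restrictScalars ℤ_[p])
  -- (3) integrality reflects along the injective `ψ`
  have hinj : Function.Injective (ψ.restrictScalars ℤ_[p]) := fun x y hxy =>
    packetAlgHom_injective p k (fun _ : I => PadicAlgCl p) ι ψ hψ hxy
  exact mem_normalizedPacket_of_isIntegral p k ((isIntegral_algHom_iff (ψ.restrictScalars ℤ_[p]) hinj).mp hint)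

/-- **`(⊗_i g_i)((R_I)^∼) = (R_I)^∼`** for `ℚ_p`-linear automorphisms `g_i` such that `g_i` AND `g_i⁻¹` are embedding-order elements
(`ι∘g_i = Σ_τ c_τ·τ`, `ι′∘g_i⁻¹ = Σ_τ c′_τ·τ` over embeddings `k_i → ℚ̄_p`, integral coefficients) — e.g. ALL isometries at TAME slots
(`exists_embeddingOrder_repr_of_isometry_of_not_wild`), Galois or not, in a packet of any shape. [cite: Mochizuki2012, IUTchIV Prop. 1.1 p. 9] -/
theorem congr_image_normalizedPacket_of_embeddingOrder (g : ∀ i, k i ≃ₗ[ℚ_[p]] k i)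
    (hg : ∀ i, ∃ (ι : k i →ₐ[ℚ_[p]] PadicAlgCl p) (T : Finset (k i →ₐ[ℚ_[p]] PadicAlgCl p))
      (c : (k i →ₐ[ℚ_[p]] PadicAlgCl p) → PadicAlgCl p), (∀ τ ∈ T, ‖c τ‖ ≤ 1) ∧ ∀ x, ι (g i x) = ∑ τ ∈ T, c τ * τ x)
    (hg' : ∀ i, ∃ (ι : k i →ₐ[ℚ_[p]] PadicAlgCl p) (T : Finset (k i →ₐ[ℚ_[p]] PadicAlgCl p))
      (c : (k i →ₐ[ℚ_[p]] PadicAlgCl p) → PadicAlgCl p), (∀ τ ∈ T, ‖c τ‖ ≤ 1) ∧ ∀ x, ι ((g i).symm x) = ∑ τ ∈ T, c τ * τ x) :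
    (PiTensorProduct.congr g : PacketAlgebra p k ≃ₗ[ℚ_[p]] PacketAlgebra p k) ''
        (normalizedPacket p k : Set (PacketAlgebra p k)) = normalizedPacket p k := by
  choose ι T c hc hgc using hg
  choose ι' T' c' hc' hgc' using hg'
  have h1 : ∀ z, (PiTensorProduct.congr g : PacketAlgebra p k ≃ₗ[ℚ_[p]] PacketAlgebra p k) z =
      PiTensorProduct.map (fun i => (g i : k i →ₗ[ℚ_[p]] k i)) z := fun z => rfl
  have h2 : ∀ z, (PiTensorProduct.congr g : PacketAlgebra p k ≃ₗ[ℚ_[p]] PacketAlgebra p k).symm z =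
      PiTensorProduct.map (fun i => ((g i).symm : k i →ₗ[ℚ_[p]] k i)) z := fun z => rfl
  apply Set.Subset.antisymm
  · rintro _ ⟨z, hz, rfl⟩
    rw [h1]
    exact map_mem_normalizedPacket_of_embeddingOrder p k ι T c hc _ (fun i x => hgc i x) hz
  · intro z hz
    refine ⟨(PiTensorProduct.congr g : PacketAlgebra p k ≃ₗ[ℚ_[p]] PacketAlgebra p k).symm z, ?_,
      LinearEquiv.apply_symm_apply _ _⟩
    rw [h2]
    exact map_mem_normalizedPacket_of_embeddingOrder p k ι' T' c' hc' _ (fun i x => hgc' i x) hz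

/-- … hence `(⊗_i g_i)(n·(R_I)^∼) = n·(R_I)^∼` for every natural number `n` (`⊗_i g_i` is additive) — the `p^λ·(R_I)^∼`-boxes of
[IUTchIV] Prop. 1.1 / 1.4 are stable under embedding-order units. [cite: Mochizuki2012, IUTchIV Prop. 1.1 p. 9] -/
theorem congr_image_natCast_smul_normalizedPacket_of_embeddingOrder (g : ∀ i, k i ≃ₗ[ℚ_[p]] k i)
    (hg : ∀ i, ∃ (ι : k i →ₐ[ℚ_[p]] PadicAlgCl p) (T : Finset (k i →ₐ[ℚ_[p]] PadicAlgCl p))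
      (c : (k i →ₐ[ℚ_[p]] PadicAlgCl p) → PadicAlgCl p), (∀ τ ∈ T, ‖c τ‖ ≤ 1) ∧ ∀ x, ι (g i x) = ∑ τ ∈ T, c τ * τ x)
    (hg' : ∀ i, ∃ (ι : k i →ₐ[ℚ_[p]] PadicAlgCl p) (T : Finset (k i →ₐ[ℚ_[p]] PadicAlgCl p))
      (c : (k i →ₐ[ℚ_[p]] PadicAlgCl p) → PadicAlgCl p), (∀ τ ∈ T, ‖c τ‖ ≤ 1) ∧ ∀ x, ι ((g i).symm x) = ∑ τ ∈ T, c τ * τ x)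
    (n : ℕ) :
    (PiTensorProduct.congr g : PacketAlgebra p k ≃ₗ[ℚ_[p]] PacketAlgebra p k) ''
        ((n : PacketAlgebra p k) • (normalizedPacket p k : Set (PacketAlgebra p k))) =
      (n : PacketAlgebra p k) • (normalizedPacket p k : Set (PacketAlgebra p k)) := by
  conv_rhs => rw [← congr_image_normalizedPacket_of_embeddingOrder p k g hg hg']
  rw [← Set.image_smul, ← Set.image_smul, Set.image_image, Set.image_image]
  exact Set.image_congr fun v _ => by rw [smul_eq_mul, smul_eq_mul, ← nsmul_eq_mul, ← nsmul_eq_mul, map_nsmul]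

end Packet

end EmbeddingOrder

end Literature.IUT.LogVolume

end
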